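import Summits.KontsevichZagierPeriods.KontsevichZagierPeriods.Theses.HodgeColevel
import Literature.NumberTheory.Transcendental.LindemannWeierstrassProofs
import Literature.NumberTheory.Transcendental.KZCubeProducts
import Summits.KontsevichZagierPeriods.KontsevichZagierPeriods.Theorems.HurwitzSectorComplement.Negative.DimZero

/-!
# `PiPowNotConstant` (stmt-KontsevichZagierPeriods-6180) — the `π`-tower against points

Closing file for the HodgeColevel support item 6180 (the `m = 0` slice of `PiPowDegree`): for
`n ≥ 1` the cube representation `[(0,1)ⁿ, ∏ᵢ 4/(1+zᵢ²)]` of `πⁿ` is not KZ-equivalent to any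
`0`-dimensional integral representation.

Proof. Soundness of the calculus (`KZ.Equivalent.value_eq_holds`) transports values; the value of a
`0`-dimensional representation is a real algebraic number (REUSED tree lemma
`HurwitzSectorComplement.Negative.isAlgebraic_value_dimZero`: a `ℚ`-semialgebraic point of `ℝ¹` is
algebraic); the value of the cube representation is `πⁿ` (`value_eq_pi_pow`: the cube's restricted
Lebesgue measure is the product measure, REUSED `KZ.volume_restrict_setOf_forall_apply_mem_Ioo`,
Fubini for products `MeasureTheory.integral_fintype_prod_eq_prod`, and the one-variable value
`∫₀¹ 4/(1+x²) dx = 4 arctan 1 = π`, `integral_Ioo_four_div_one_add_sq`); finally `πⁿ` algebraic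
with `n ≥ 1` forces `π` algebraic (`IsAlgebraic.of_pow`), contradicting Lindemann
(`transcendental_pi_holds`, PROVED in tree). Prepared by the lead seat c5 of crux
stmt-KontsevichZagierPeriods-3869 (line SketchIdeator1).

Sources: M. Kontsevich, D. Zagier, *Periods* (2001), §1.1 (`π = ∬_{x²+y²≤1} dx dy`, constants),
§1.2 (soundness of the rules), §4.1 (Fubini: products of integrals are integrals); F. Lindemann,
*Über die Zahl π*, Math. Ann. 20 (1882). No definitions are introduced.
-/

noncomputable section

open MeasureTheory Set
open Literature.NumberTheory.Transcendental Literature.NumberTheory.Transcendental.KZ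
open Summit.KontsevichZagierPeriods.Theorems.HurwitzSectorComplement.Negative
  (isAlgebraic_value_dimZero)

namespace Summit.KontsevichZagierPeriods.HodgeColevel.PiPowNotConstant

/-- **The one-variable value**: `∫_{(0,1)} 4/(1+x²) dx = 4 (arctan 1 − arctan 0) = π`.
[cite: KontsevichZagier2001, §1.1] -/
theorem integral_Ioo_four_div_one_add_sq :
    ∫ x in Set.Ioo (0:ℝ) 1, 4 / (1 + x ^ 2) = Real.pi := by
  rw [← integral_Ioc_eq_integral_Ioo, ← intervalIntegral.integral_of_le zero_le_one]
  have : (fun t : ℝ => 4 / (1 + t ^ 2)) = fun t => 4 * (1 / (1 + t ^ 2)) := by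
    funext t; rw [mul_one_div]
  rw [this, intervalIntegral.integral_const_mul, integral_one_div_one_add_sq, Real.arctan_one,
    Real.arctan_zero, sub_zero]
  ring

/-- **The value of the cube representation of `πⁿ`**: a representation with domain the open unit
cube `(0,1)ⁿ` and integrand `∏ᵢ 4/(1+zᵢ²)` on it has value `πⁿ` (product measure + Fubini for
products + the one-variable value). [cite: KontsevichZagier2001, §4.1] -/
theorem value_eq_pi_pow {n : ℕ} (r : IntegralRep n)
    (hrd : r.domain = {z | ∀ i, z i ∈ Set.Ioo (0:ℝ) 1})
    (hri : EqOn r.integrand (fun z => ∏ i, 4 / (1 + z i ^ 2)) r.domain) :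
    r.value = Real.pi ^ n := by
  rw [IntegralRep.value, setIntegral_congr_fun (IntegralRep.measurableSet_domain_holds r) hri, hrd,
    volume_restrict_setOf_forall_apply_mem_Ioo,
    integral_fintype_prod_eq_prod (fun (_ : Fin n) (x : ℝ) => 4 / (1 + x ^ 2)),
    Finset.prod_const, Finset.card_univ, Fintype.card_fin, integral_Ioo_four_div_one_add_sq]

/-- **The `π`-tower is not constant** (item stmt-KontsevichZagierPeriods-6180): for `n ≥ 1` the
cube representation `[(0,1)ⁿ, ∏ᵢ 4/(1+zᵢ²)]` of `πⁿ` is not KZ-equivalent to any `0`-dimensional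
representation — soundness transports the value `πⁿ` to the algebraic value of a point, and
`πⁿ ∈ ℚ̄` with `n ≥ 1` contradicts the transcendence of `π`.
[cite: Lindemann1882, via BakerTNT1975 Ch. 1 Theorem 1.3, p. 5] -/
theorem piPowNotConstant_proof :
    Summit.KontsevichZagierPeriods.KontsevichZagierPeriods.Theses.HodgeColevel.PiPowNotConstant := by
  intro n hn r hrd hri r' hE
  have hv : r.value = r'.value := Equivalent.value_eq_holds hE
  have halg : IsAlgebraic ℚ (Real.pi ^ n) := by
    rw [← value_eq_pi_pow r hrd hri, hv]
    exact isAlgebraic_value_dimZero r'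
  exact transcendental_pi_holds (halg.of_pow hn)

end Summit.KontsevichZagierPeriods.HodgeColevel.PiPowNotConstant

end
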